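import Summits.Schanuel.Schanuel.Theorems.RootDecomp1KOnePointCell05

/-!
# RootDecomp1KOnePointCell — lens 1, generation 39 «ONE-POINT ZERO ESTIMATE + LOG-LOG WALL CELL of 33364» ((1, ℓ₂, ℓ₃, ρ) for every log-log-Liouville ρ) — continuation (RootDecomp1KOnePointCell06): §4 (M′) `induced_logLog_measure_cons_two_three (hθ : MvPolyMeasure θ) (d)` — the induced log-log measure of the block at ONE scale via (T)

(lens-1 g39 `RootDecomp1KOnePointCell.lean` [HOME/decomp-schanuel-lens-1/g39/RootDecomp1KOnePointCell.lean sha256 4a1f4bc8…4211, 2530 l + OPprobe + OPctrl + NODE-g39.md; NOTE/CLAIM L1801, ACK + CHECKLIST K-g39 L1803, presearch (6) resolved by the critic L1810, NODE L1824 / REQUEST L1825 / RESULT L1826]; port by census-1 gen 16 in ten parts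
`RootDecomp1KOnePointCell01`–`10` — see the PORT NOTE of part 01; `--supports stmt-Schanuel-33364`; rung 0.)
-/

open Complex IntermediateField Polynomial
open Summit.Schanuel.Schanuel.Theorems.RootDecomp1KHyper
open Summit.Schanuel.Schanuel.Theorems.RootDecomp1KHyper.HyperCell
open Summit.Schanuel.Schanuel.Theorems.RootDecomp1KGeneric
open Summit.Schanuel.Schanuel.Theorems.RootDecomp1KRelLiouvilleCell
open Summit.Schanuel.Schanuel.Theorems.RootDecomp1KLogLogCell
open Summit.Schanuel.Schanuel.Theorems.RootDecomp1KTwoBaseCell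
open Summit.Schanuel.Schanuel.Theorems.RootDecomp1KMeasuredWallCell

namespace Summit.Schanuel.Schanuel.Theorems.RootDecomp1KOnePointCell

section BlockMeasure
open LiouvilleNumber
open scoped Nat

variable {n : ℕ}

/-- `6 ≤ e²`. -/
private theorem six_le_exp_two'' : (6 : ℝ) ≤ Real.exp 2 := by
  have h : Real.exp 2 = Real.exp 1 ^ 2 := by rw [← Real.exp_nat_mul]; norm_num
  rw [h]
  have h1 := Real.exp_one_gt_d9
  calc (6 : ℝ) ≤ (2.7182818283 : ℝ) ^ 2 := by norm_num
    _ ≤ Real.exp 1 ^ 2 := pow_le_pow_left₀ (by norm_num) h1.le 2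

/-- **(M′) THE INDUCED LOG-LOG MEASURE (θ⃗-quantified).** If `θ = (θ₁,…,θₙ)` has a POLYNOMIAL measure of
algebraic independence (`MvPolyMeasure θ`, tree class), then the block `(ℓ₂, ℓ₃, θ₁, …, θₙ)` has a LOG-LOG
measure (tree class `LogLogCell.LogLogMeasure`): `|P(ℓ₂, ℓ₃, θ)| ≥ exp(−C (1 + log len P)(1 + log(1 + log len P)))`
for all non-zero `P ∈ ℤ[X₀,…,X_{n+1}]` of total degree `≤ d`.  Mechanism: ONE scale `K` — the least admissible
index with `2^{K!} ≥ Y := 4ΓC₁ (len P)^{1+τ+2·6^d}` (`exists_scale_index`, so `K! ≲ log len · loglog len`) — at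
which the ONE-POINT ESTIMATE (T) `onePoint_nonvanishing` makes the integer specialisation
`H = 6^{dK!} P(s²_K, s³_K, X⃗)` NON-ZERO (`wspec_ne_zero` ∘ `sliceXY_ne_zero`, tree); the measure of `θ` bounds
`|H(θ)|` below and the factorial tails `|ℓ_b − s^b_K| ≤ 2·2^{−(K+1)!}` are smaller (`Y · 6^{K!d(τ+1)} ≤ 2^{(K+1)!}`).
Versus g38's (M) (`LogPowMeasure`, exponent `d + 3`, window of `d + 1` scales): one scale, hence LOG-LOG — which is
SHARP for this block (the `d = 1` forms `3^{K!}x − psNumer 3 K` have `|F(ℓ₃)| = len^{−K(1+o(1))}`,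
`K ≍ loglog len / logloglog len`).  No named fact enters. -/
theorem induced_logLog_measure_cons_two_three {θ : Fin n → ℂ} (hθ : MvPolyMeasure θ) (d : ℕ) :
    ∃ C : ℝ, 0 < C ∧ ∀ P : MvPolynomial (Fin (n + 2)) ℤ, P ≠ 0 → P.totalDegree ≤ d →
      Real.exp (-(C * (1 + Real.log ((mvlen P : ℤ) : ℝ)) *
        (1 + Real.log (1 + Real.log ((mvlen P : ℤ) : ℝ))))) ≤
        ‖MvPolynomial.aeval (Fin.cons ((liouvilleNumber 2 : ℝ) : ℂ)
          (Fin.cons ((liouvilleNumber 3 : ℝ) : ℂ) θ) : Fin (n + 2) → ℂ) P‖ := by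
  classical
  obtain ⟨C₀, τ, hC₀, hmeas₀⟩ := hθ d
  -- WLOG the measure constant is ≥ 1
  set Cθ : ℝ := max C₀ 1 with hCθdef
  have hCθ1 : 1 ≤ Cθ := le_max_right _ _
  have hCθ : 0 < Cθ := by linarith
  have hmeas : ∀ P : MvPolynomial (Fin n) ℤ, P ≠ 0 → P.totalDegree ≤ d →
      1 ≤ Cθ * ((mvlen P : ℤ) : ℝ) ^ τ * ‖MvPolynomial.aeval θ P‖ := by
    intro P hP hdeg
    refine (hmeas₀ P hP hdeg).trans ?_
    have h0 : (0 : ℝ) ≤ ((mvlen P : ℤ) : ℝ) ^ τ := pow_nonneg (by exact_mod_cast mvlen_nonneg P) τ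
    exact mul_le_mul_of_nonneg_right (mul_le_mul_of_nonneg_right (le_max_left _ _) h0)
      (norm_nonneg _)
  -- the size of θ and the constants of the node
  set B : ℝ := 2 + ∑ i, ‖θ i‖ with hBdef
  have hsum0 : 0 ≤ ∑ i, ‖θ i‖ := Finset.sum_nonneg fun i _ => norm_nonneg _
  have hB2 : 2 ≤ B := by rw [hBdef]; linarith
  have hB1 : 1 ≤ B := by linarith
  have hθB : ∀ i, ‖θ i‖ ≤ B := fun i => by
    have := Finset.single_le_sum (f := fun i => ‖θ i‖) (fun i _ => norm_nonneg _)
      (Finset.mem_univ i)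
    rw [hBdef]; linarith
  set Γ : ℝ := (d : ℝ) * B ^ d + 1 with hΓdef
  have hΓ0 : (0 : ℝ) ≤ (d : ℝ) * B ^ d := by positivity
  have hΓ1 : 1 ≤ Γ := by rw [hΓdef]; linarith
  have hΓpos : 0 < Γ := by linarith
  set C₁ : ℝ := Cθ * ((2 : ℝ) ^ d) ^ τ with hC₁def
  have hC₁1 : 1 ≤ C₁ := by
    rw [hC₁def]
    exact one_le_mul_of_one_le_of_one_le hCθ1 (one_le_pow₀ (one_le_pow₀ (by norm_num)))
  have hC₁pos : 0 < C₁ := by linarith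
  set E : ℕ := d * (τ + 1) with hEdef
  -- the exponent `w = 2·6^d` of the one-point estimate and the least admissible scale index `N_d`
  set w : ℕ := 2 * 6 ^ d with hwdef
  set Nd : ℕ := 3 * E + 6 ^ (d + 2) * (d + 1) with hNddef
  have h4ΓC₁ : (1 : ℝ) ≤ 4 * Γ * C₁ := one_le_mul_of_one_le_of_one_le (by linarith) hC₁1
  have hlog4 : 0 ≤ Real.log (4 * Γ * C₁) := Real.log_nonneg h4ΓC₁
  set cY : ℝ := Real.log (4 * Γ * C₁) + 1 + τ + w + 1 with hcYdef
  have hcY1 : 1 ≤ cY := by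
    rw [hcYdef]
    linarith [(Nat.cast_nonneg τ : (0 : ℝ) ≤ τ), (Nat.cast_nonneg w : (0 : ℝ) ≤ w)]
  have hcY0 : 0 ≤ cY := by linarith
  set c₁ : ℝ := 2 * cY + 1 with hc₁def
  have hc₁1 : 1 ≤ c₁ := by rw [hc₁def]; linarith
  have hlogc₁ : 0 ≤ Real.log c₁ := Real.log_nonneg hc₁1
  set A₀ : ℝ := ((Nd ! : ℕ) : ℝ) + 2 * c₁ * (1 + Real.log c₁) with hA₀def
  have hA₀0 : 0 ≤ A₀ := by positivity
  set D : ℝ := 2 * (E : ℝ) with hDdef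
  have hD0 : 0 ≤ D := by positivity
  set Cst : ℝ := 2 * C₁ + τ + D * A₀ + 1 with hCstdef
  refine ⟨Cst, by positivity, fun P hP hdeg => ?_⟩
  clear_value Cst A₀ c₁ cY C₁ Γ B Cθ D
  -- notation for P
  set L : ℝ := ((mvlen P : ℤ) : ℝ) with hLdef
  have hL1 : 1 ≤ L := by rw [hLdef]; exact_mod_cast one_le_mvlen hP
  have hL0 : 0 ≤ L := by linarith
  have hlogL0 : 0 ≤ Real.log L := Real.log_nonneg hL1
  set u : ℝ := 1 + Real.log L with hudef
  have hu1 : 1 ≤ u := by rw [hudef]; linarith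
  have hu0 : 0 ≤ u := by linarith
  set v : ℝ := 1 + Real.log u with hvdef
  have hv1 : 1 ≤ v := by rw [hvdef]; linarith [Real.log_nonneg hu1]
  have huv1 : 1 ≤ u * v := one_le_mul_of_one_le_of_one_le hu1 hv1
  have hLuv : Real.log L ≤ u * v :=
    (show Real.log L ≤ u by rw [hudef]; linarith).trans (le_mul_of_one_le_right hu0 hv1)
  have hℓ₂pos : 0 < liouvilleNumber 2 := liouvilleNumber_two_pos
  have hℓ₂lt : liouvilleNumber 2 < 3 / 2 := liouvilleNumber_two_lt
  have hℓ₃lt : liouvilleNumber 3 < 1 := liouvilleNumber_three_lt_one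
  have hℓ₃pos : 0 < liouvilleNumber 3 := by
    have := partialSum_pos_lt (by norm_num : (1 : ℝ) < 3) 0
    linarith [this.1, this.2]
  -- Lipschitz: ‖P(ℓ₂,ℓ₃,θ) − P(s²_K, s³_K, θ)‖ ≤ Γ L · 2·2^{−(K+1)!}
  have hLsum : (∑ e ∈ P.support, |((P.coeff e : ℤ) : ℝ)|) = L := by
    rw [hLdef]; unfold mvlen; push_cast; rfl
  have htail : ∀ K : ℕ,
      ‖MvPolynomial.aeval (Fin.cons ((liouvilleNumber 2 : ℝ) : ℂ)
          (Fin.cons ((liouvilleNumber 3 : ℝ) : ℂ) θ) : Fin (n + 2) → ℂ) P -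
        MvPolynomial.aeval (Fin.cons ((partialSum 2 K : ℝ) : ℂ)
          (Fin.cons ((partialSum 3 K : ℝ) : ℂ) θ) : Fin (n + 2) → ℂ) P‖ ≤
        Γ * L * (2 / 2 ^ (K + 1)!) := by
    intro K
    have hs2 := partialSum_pos_lt (by norm_num : (1 : ℝ) < 2) K
    have hs3 := partialSum_pos_lt (by norm_num : (1 : ℝ) < 3) K
    have hδ : (0 : ℝ) ≤ 2 / 2 ^ (K + 1)! := by positivity
    have hx : ∀ i, ‖(Fin.cons ((liouvilleNumber 2 : ℝ) : ℂ)
        (Fin.cons ((liouvilleNumber 3 : ℝ) : ℂ) θ) : Fin (n + 2) → ℂ) i‖ ≤ B := by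
      intro i
      refine Fin.cases ?_ (fun i' => ?_) i
      · simp only [Fin.cons_zero, Complex.norm_real, Real.norm_eq_abs]
        rw [abs_of_pos hℓ₂pos]; linarith
      · refine Fin.cases ?_ (fun j => ?_) i'
        · simp only [Fin.cons_succ, Fin.cons_zero, Complex.norm_real, Real.norm_eq_abs]
          rw [abs_of_pos hℓ₃pos]; linarith
        · simp only [Fin.cons_succ]; exact hθB j
    have hy : ∀ i, ‖(Fin.cons ((partialSum 2 K : ℝ) : ℂ)
        (Fin.cons ((partialSum 3 K : ℝ) : ℂ) θ) : Fin (n + 2) → ℂ) i‖ ≤ B := by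
      intro i
      refine Fin.cases ?_ (fun i' => ?_) i
      · simp only [Fin.cons_zero, Complex.norm_real, Real.norm_eq_abs]
        rw [abs_of_pos hs2.1]; linarith
      · refine Fin.cases ?_ (fun j => ?_) i'
        · simp only [Fin.cons_succ, Fin.cons_zero, Complex.norm_real, Real.norm_eq_abs]
          rw [abs_of_pos hs3.1]; linarith
        · simp only [Fin.cons_succ]; exact hθB j
    have hxy : ∀ i, ‖(Fin.cons ((liouvilleNumber 2 : ℝ) : ℂ)
        (Fin.cons ((liouvilleNumber 3 : ℝ) : ℂ) θ) : Fin (n + 2) → ℂ) i -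
        (Fin.cons ((partialSum 2 K : ℝ) : ℂ)
          (Fin.cons ((partialSum 3 K : ℝ) : ℂ) θ) : Fin (n + 2) → ℂ) i‖ ≤ 2 / 2 ^ (K + 1)! := by
      intro i
      refine Fin.cases ?_ (fun i' => ?_) i
      · simp only [Fin.cons_zero]
        rw [← Complex.ofReal_sub, Complex.norm_real, Real.norm_eq_abs]
        exact abs_liouvilleNumber_sub_partialSum_le (by norm_num) K
      · refine Fin.cases ?_ (fun j => ?_) i'
        · simp only [Fin.cons_succ, Fin.cons_zero]
          rw [← Complex.ofReal_sub, Complex.norm_real, Real.norm_eq_abs]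
          exact abs_liouvilleNumber_sub_partialSum_le (by norm_num) K
        · simp only [Fin.cons_succ, sub_self, norm_zero]; exact hδ
    have h := norm_aeval_sub_aeval_le P hB1 hδ hx hy hxy hdeg
    rw [hLsum] at h
    refine h.trans ?_
    have hΓ' : (d : ℝ) * B ^ d ≤ Γ := by rw [hΓdef]; linarith
    calc L * ((d : ℝ) * B ^ d * (2 / 2 ^ (K + 1)!))
        = ((d : ℝ) * B ^ d) * (L * (2 / 2 ^ (K + 1)!)) := by ring
      _ ≤ Γ * (L * (2 / 2 ^ (K + 1)!)) := mul_le_mul_of_nonneg_right hΓ' (by positivity)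
      _ = Γ * L * (2 / 2 ^ (K + 1)!) := by ring
  -- the ONE scale K: Y := 4ΓC₁ L^{1+τ+w} ≤ 2^{K!}, K ≥ N_d
  set Y : ℝ := 4 * Γ * C₁ * L ^ (1 + τ + w) with hYdef
  have hLpoww : L ^ w ≤ L ^ (1 + τ + w) := pow_le_pow_right₀ hL1 (by omega)
  have hLpow1' : 1 ≤ L ^ (1 + τ + w) := one_le_pow₀ hL1
  have hY1 : 1 ≤ Y := by
    rw [hYdef]; exact one_le_mul_of_one_le_of_one_le h4ΓC₁ hLpow1'
  have hYpos : 0 < Y := lt_of_lt_of_le one_pos hY1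
  have hYLw : L ^ w ≤ Y := by
    rw [hYdef]
    calc L ^ w ≤ L ^ (1 + τ + w) := hLpoww
      _ = 1 * L ^ (1 + τ + w) := (one_mul _).symm
      _ ≤ 4 * Γ * C₁ * L ^ (1 + τ + w) := mul_le_mul_of_nonneg_right h4ΓC₁ (by positivity)
  have hlogY : Real.log Y ≤ cY * u := by
    have e1 : Real.log Y = Real.log (4 * Γ * C₁) + (1 + τ + w) * Real.log L := by
      rw [hYdef, Real.log_mul (by positivity) (by positivity), Real.log_pow]; push_cast; ring
    rw [e1, hcYdef]
    have h1 : (1 + (τ : ℝ) + w) * Real.log L ≤ (1 + τ + w) * u := by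
      apply mul_le_mul_of_nonneg_left _ (by positivity); rw [hudef]; linarith
    have h2 : Real.log (4 * Γ * C₁) * 1 ≤ Real.log (4 * Γ * C₁) * u :=
      mul_le_mul_of_nonneg_left hu1 hlog4
    have e2 : (Real.log (4 * Γ * C₁) + 1 + τ + w + 1) * u =
        Real.log (4 * Γ * C₁) * u + (1 + τ + w) * u + u := by ring
    rw [e2]
    linarith
  have hlogY0 : 0 ≤ Real.log Y := Real.log_nonneg hY1
  clear_value Y
  obtain ⟨K, hNdK, hKY, hKfact0⟩ := exists_scale_index Y hY1 Nd
  have hK3E : 3 * E ≤ K := le_trans (Nat.le_add_right _ _) hNdK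
  have hKthr : 6 ^ (d + 2) * (d + 1) ≤ K := le_trans (Nat.le_add_left _ _) hNdK
  -- the slice at a support exponent and THE ONE-POINT ZERO ESTIMATE at the scale K
  have hsupp : P.support.Nonempty :=
    Finset.nonempty_iff_ne_empty.mpr fun h => hP (MvPolynomial.support_eq_empty.mp h)
  obtain ⟨e₀, he₀⟩ := hsupp
  set F : ℤ[X][X] := sliceXY P (Finsupp.tail (Finsupp.tail e₀)) with hFdef
  have hF0 : F ≠ 0 := sliceXY_ne_zero P he₀
  have hLZ : (mvlen P) ^ (2 * 6 ^ d) ≤ (2 : ℤ) ^ K ! := by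
    have h1 : L ^ w ≤ (2 : ℝ) ^ K ! := hYLw.trans hKY
    rw [hLdef, hwdef] at h1
    exact_mod_cast h1
  have hKne := onePoint_nonvanishing F hF0 (natDegree_sliceXY_le P hdeg _)
    (natDegree_coeff_sliceXY_le P hdeg _) (abs_coeff_coeff_sliceXY_le P _) hKthr hLZ
  -- the point (s²_K, s³_K) = (a₂/q₂, a₃/q₃)
  set s2 : ℝ := partialSum 2 K with hs2def
  set s3 : ℝ := partialSum 3 K with hs3def
  have hs2 := partialSum_pos_lt (by norm_num : (1 : ℝ) < 2) K
  have hs3 := partialSum_pos_lt (by norm_num : (1 : ℝ) < 3) K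
  rw [← hs2def] at hs2
  rw [← hs3def] at hs3
  set a₂ : ℤ := (psNumer 2 K : ℤ) with ha₂def
  set a₃ : ℤ := (psNumer 3 K : ℤ) with ha₃def
  set q₂ : ℕ := 2 ^ K ! with hq₂def
  set q₃ : ℕ := 3 ^ K ! with hq₃def
  have hq₂0 : q₂ ≠ 0 := by positivity
  have hq₃0 : q₃ ≠ 0 := by positivity
  have hq₂pos : (0 : ℝ) < q₂ := by positivity
  have hq₃pos : (0 : ℝ) < q₃ := by positivity
  have hs2eq : s2 = (a₂ : ℝ) / (q₂ : ℝ) := by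
    have := partialSum_eq_psNumer_div (b := 2) (by norm_num) K
    simp only [Nat.cast_ofNat] at this
    rw [hs2def, this, ha₂def, hq₂def]; push_cast; rfl
  have hs3eq : s3 = (a₃ : ℝ) / (q₃ : ℝ) := by
    have := partialSum_eq_psNumer_div (b := 3) (by norm_num) K
    simp only [Nat.cast_ofNat] at this
    rw [hs3def, this, ha₃def, hq₃def]; push_cast; rfl
  have hpsQ2 : psQ 2 K = (a₂ : ℚ) / (q₂ : ℚ) := by
    rw [psQ_eq_div (by norm_num), ha₂def, hq₂def]; push_cast; rfl
  have hpsQ3 : psQ 3 K = (a₃ : ℚ) / (q₃ : ℚ) := by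
    rw [psQ_eq_div (by norm_num), ha₃def, hq₃def]; push_cast; rfl
  rw [hpsQ2, hpsQ3] at hKne
  -- the integer specialisation H = 6^{dK!} P(s²_K, s³_K, X⃗)
  set H : MvPolynomial (Fin n) ℤ := wspec P d a₂ a₃ q₂ q₃ with hHdef
  have hH0 : H ≠ 0 := wspec_ne_zero P hdeg a₂ a₃ hq₂0 hq₃0 hKne
  have hHdeg : H.totalDegree ≤ d := totalDegree_wspec_le P hdeg _ _ _ _
  have ha₂ : |a₂| ≤ 2 * (q₂ : ℤ) := by
    rw [abs_of_nonneg (by positivity)]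
    have h1 : (a₂ : ℝ) / q₂ < 2 := by rw [← hs2eq]; linarith [hs2.2]
    have h2 : (a₂ : ℝ) < 2 * q₂ := by rwa [div_lt_iff₀ hq₂pos] at h1
    exact_mod_cast h2.le
  have ha₃ : |a₃| ≤ (q₃ : ℤ) := by
    rw [abs_of_nonneg (by positivity)]
    have h1 : (a₃ : ℝ) / q₃ < 1 := by rw [← hs3eq]; linarith [hs3.2]
    have h2 : (a₃ : ℝ) < q₃ := by rwa [div_lt_one hq₃pos] at h1
    exact_mod_cast h2.le
  set G : ℝ := (6 : ℝ) ^ K ! with hGdef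
  have hq₂q₃ : (q₂ : ℝ) * (q₃ : ℝ) = G := by
    rw [hGdef, hq₂def, hq₃def]; push_cast; rw [← mul_pow]; norm_num
  have hG1 : 1 ≤ G := by rw [hGdef]; exact one_le_pow₀ (by norm_num)
  have hGpos : 0 < G := by linarith
  -- the length of H
  have hq₂Z : (0 : ℤ) ≤ (q₂ : ℤ) := Int.natCast_nonneg _
  have hlenHZ : mvlen H ≤ (2 * (q₂ : ℤ) * q₃) ^ d * mvlen P :=
    mvlen_wspec_le P hdeg (A₂ := 2 * (q₂ : ℤ)) (A₃ := (q₃ : ℤ)) ha₂ (by linarith) ha₃ le_rfl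
  have hlenH : ((mvlen H : ℤ) : ℝ) ≤ (2 : ℝ) ^ d * G ^ d * L := by
    have h1 : ((mvlen H : ℤ) : ℝ) ≤ (((2 * (q₂ : ℤ) * q₃) ^ d * mvlen P : ℤ) : ℝ) := by
      exact_mod_cast hlenHZ
    refine h1.trans (le_of_eq ?_)
    push_cast
    rw [← hLdef, ← hq₂q₃]
    ring
  have hlenH0 : (0 : ℝ) ≤ ((mvlen H : ℤ) : ℝ) := by exact_mod_cast mvlen_nonneg H
  -- H(θ) = G^d · P(s²_K, s³_K, θ)
  have hpt2 : ((s2 : ℝ) : ℂ) = ((a₂ : ℤ) : ℂ) / ((q₂ : ℕ) : ℂ) := by rw [hs2eq]; push_cast; rfl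
  have hpt3 : ((s3 : ℝ) : ℂ) = ((a₃ : ℤ) : ℂ) / ((q₃ : ℕ) : ℂ) := by rw [hs3eq]; push_cast; rfl
  have hHe : MvPolynomial.aeval θ H = ((q₂ : ℂ) * q₃) ^ d *
      MvPolynomial.aeval (Fin.cons ((s2 : ℝ) : ℂ) (Fin.cons ((s3 : ℝ) : ℂ) θ) : Fin (n + 2) → ℂ) P := by
    rw [hHdef, mvaeval_wspec P hdeg a₂ a₃ hq₂0 hq₃0 θ, hpt2, hpt3]
  have hHnorm : ‖MvPolynomial.aeval θ H‖ = G ^ d *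
      ‖MvPolynomial.aeval (Fin.cons ((s2 : ℝ) : ℂ) (Fin.cons ((s3 : ℝ) : ℂ) θ) : Fin (n + 2) → ℂ) P‖ := by
    rw [hHe, norm_mul, norm_pow, norm_mul, Complex.norm_natCast, Complex.norm_natCast, hq₂q₃]
  -- the measure of θ at H:  X := (C₁ L^τ G^E)⁻¹ ≤ |P(s²_K, s³_K, θ)|
  have hmeasH := hmeas H hH0 hHdeg
  clear_value H
  have hlow : 1 ≤ C₁ * L ^ τ * G ^ E *
      ‖MvPolynomial.aeval (Fin.cons ((s2 : ℝ) : ℂ) (Fin.cons ((s3 : ℝ) : ℂ) θ) : Fin (n + 2) → ℂ) P‖ := by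
    rw [hHnorm] at hmeasH
    have e1 : ((mvlen H : ℤ) : ℝ) ^ τ ≤ ((2 : ℝ) ^ d * G ^ d * L) ^ τ :=
      pow_le_pow_left₀ hlenH0 hlenH τ
    have e3 : Cθ * ((mvlen H : ℤ) : ℝ) ^ τ ≤ Cθ * ((2 : ℝ) ^ d * G ^ d * L) ^ τ :=
      mul_le_mul_of_nonneg_left e1 hCθ.le
    calc (1 : ℝ) ≤ Cθ * ((mvlen H : ℤ) : ℝ) ^ τ * (G ^ d *
          ‖MvPolynomial.aeval (Fin.cons ((s2 : ℝ) : ℂ) (Fin.cons ((s3 : ℝ) : ℂ) θ) :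
            Fin (n + 2) → ℂ) P‖) := hmeasH
      _ ≤ Cθ * ((2 : ℝ) ^ d * G ^ d * L) ^ τ * (G ^ d *
          ‖MvPolynomial.aeval (Fin.cons ((s2 : ℝ) : ℂ) (Fin.cons ((s3 : ℝ) : ℂ) θ) :
            Fin (n + 2) → ℂ) P‖) := mul_le_mul_of_nonneg_right e3 (by positivity)
      _ = C₁ * L ^ τ * G ^ E *
          ‖MvPolynomial.aeval (Fin.cons ((s2 : ℝ) : ℂ) (Fin.cons ((s3 : ℝ) : ℂ) θ) :
            Fin (n + 2) → ℂ) P‖ := by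
          rw [hC₁def, hEdef, Nat.mul_succ, pow_add, pow_mul]
          simp only [mul_pow]
          ring
  set X : ℝ := (C₁ * L ^ τ * G ^ E)⁻¹ with hXdef
  have hDpos : 0 < C₁ * L ^ τ * G ^ E := by positivity
  have hXpos : 0 < X := inv_pos.mpr hDpos
  have hXle : X ≤
      ‖MvPolynomial.aeval (Fin.cons ((s2 : ℝ) : ℂ) (Fin.cons ((s3 : ℝ) : ℂ) θ) : Fin (n + 2) → ℂ) P‖ := by
    rw [hXdef, inv_le_iff_one_le_mul₀' hDpos]; exact hlow
  clear_value X
  -- the scale inequality  Y · G^E ≤ 2^{(K+1)!}  (K ≥ 3E, 6^{K!} ≤ (2^{K!})^3, Y ≤ 2^{K!})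
  have hwin_ineq : Y * G ^ E ≤ (2 : ℝ) ^ (K + 1)! := by
    set q : ℝ := (2 : ℝ) ^ K ! with hqdef
    have hq1 : 1 ≤ q := by rw [hqdef]; exact one_le_pow₀ (by norm_num)
    have e1 : (2 : ℝ) ^ (K + 1)! = q ^ (K + 1) := by
      rw [hqdef, ← pow_mul, Nat.factorial_succ, mul_comm]
    have hYq : Y ≤ q := by rw [hqdef]; exact hKY
    have hGq : G ≤ q ^ 3 := by
      rw [hGdef, hqdef, ← pow_mul]
      calc (6 : ℝ) ^ K ! ≤ 8 ^ K ! := pow_le_pow_left₀ (by norm_num) (by norm_num) _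
        _ = 2 ^ (K ! * 3) := by rw [mul_comm, pow_mul]; norm_num
    have hGE : G ^ E ≤ (q ^ 3) ^ E := pow_le_pow_left₀ hGpos.le hGq E
    rw [e1]
    calc Y * G ^ E ≤ q * (q ^ 3) ^ E := mul_le_mul hYq hGE (by positivity) (by positivity)
      _ = q ^ (3 * E + 1) := by rw [← pow_mul]; ring
      _ ≤ q ^ (K + 1) := pow_le_pow_right₀ hq1 (by omega)
  have htail2 : Γ * L * (2 / 2 ^ (K + 1)!) ≤ X / 2 := by
    have hpow_pos : (0 : ℝ) < 2 ^ (K + 1)! := by positivity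
    have hY₀ : 4 * Γ * C₁ * L ^ (1 + τ) ≤ Y := by
      rw [hYdef]
      exact mul_le_mul_of_nonneg_left (pow_le_pow_right₀ hL1 (by omega)) (by positivity)
    have hY₀G : 4 * Γ * C₁ * L ^ (1 + τ) * G ^ E ≤ (2 : ℝ) ^ (K + 1)! :=
      (mul_le_mul_of_nonneg_right hY₀ (by positivity)).trans hwin_ineq
    have h2 : (2 : ℝ) / 2 ^ (K + 1)! ≤ 2 / (4 * Γ * C₁ * L ^ (1 + τ) * G ^ E) :=
      div_le_div_of_nonneg_left (by norm_num) (by positivity) hY₀G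
    have h3 : Γ * L * (2 / (4 * Γ * C₁ * L ^ (1 + τ) * G ^ E)) = X / 2 := by
      rw [hXdef]
      have hLτ : L ^ (1 + τ) = L * L ^ τ := by rw [pow_add, pow_one]
      rw [hLτ]
      field_simp
      ring
    calc Γ * L * (2 / 2 ^ (K + 1)!) ≤ Γ * L * (2 / (4 * Γ * C₁ * L ^ (1 + τ) * G ^ E)) :=
          mul_le_mul_of_nonneg_left h2 (by positivity)
      _ = X / 2 := h3
  -- hence |P(ℓ₂, ℓ₃, θ)| ≥ X / 2
  have hfinal : X / 2 ≤ ‖MvPolynomial.aeval (Fin.cons ((liouvilleNumber 2 : ℝ) : ℂ)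
      (Fin.cons ((liouvilleNumber 3 : ℝ) : ℂ) θ) : Fin (n + 2) → ℂ) P‖ := by
    have ht := htail K
    have h1 := norm_sub_norm_le
      (MvPolynomial.aeval (Fin.cons ((s2 : ℝ) : ℂ) (Fin.cons ((s3 : ℝ) : ℂ) θ) : Fin (n + 2) → ℂ) P)
      (MvPolynomial.aeval (Fin.cons ((liouvilleNumber 2 : ℝ) : ℂ)
        (Fin.cons ((liouvilleNumber 3 : ℝ) : ℂ) θ) : Fin (n + 2) → ℂ) P)
    rw [norm_sub_rev] at h1
    rw [hs2def, hs3def] at h1 hXle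
    linarith
  refine le_trans ?_ hfinal
  -- it remains: exp(−Cst u v) ≤ X / 2, i.e. 2 C₁ L^τ G^E ≤ exp(Cst u v)
  have hX2 : X / 2 = (2 * C₁ * L ^ τ * G ^ E)⁻¹ := by
    rw [hXdef, div_eq_mul_inv, ← mul_inv]
    congr 1
    ring
  rw [hX2, Real.exp_neg]
  refine inv_anti₀ (by positivity) ?_
  have hNfact : ((K ! : ℕ) : ℝ) ≤ A₀ * (u * v) ^ 1 := by
    rw [pow_one, hA₀def]
    exact factorial_scale_le hKfact0 hlogY0 hlogY hcY1 hu1 hc₁def hvdef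
  have hqpow : G ^ E ≤ Real.exp (D * (K ! : ℕ)) := by
    rw [hGdef, hDdef, ← pow_mul]
    calc ((6 : ℝ) ^ (K ! * E)) ≤ (Real.exp 2) ^ (K ! * E) :=
          pow_le_pow_left₀ (by norm_num) six_le_exp_two'' _
      _ = Real.exp (2 * (E : ℝ) * (K ! : ℕ)) := by
          rw [← Real.exp_nat_mul]; congr 1; push_cast; ring
  have e : Cst * u * v = (2 * C₁ + τ + D * A₀ + 1) * (u * v) ^ 1 := by
    rw [hCstdef, pow_one, mul_assoc]
  rw [e]
  exact two_mul_prod_le_exp hC₁pos (by linarith) hLuv huv1 le_rfl hD0 hA₀0 (by positivity) hqpow hNfact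

end BlockMeasure

end Summit.Schanuel.Schanuel.Theorems.RootDecomp1KOnePointCell
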